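import Literature.Barriers.AtomisticToContinuum.NoBVEstimatesMultiDDerivedCurves
import Mathlib.Analysis.InnerProductSpace.Calculus
import HarnessLib

/-!
# The symmetrizer-weighted energy of the regularised quasilinear flow and its time derivative

Brick B-δ, §3, of the Kato existence programme for the symmetrizable branch of Rauch's Local
Existence Theorem (towards `Rauch1986_smallAmplitudeExpansionL2`). For the Friedrichs-regularised
flow `U' = F_δ(U)` of the cut-off quasilinear system (`NoBVEstimatesMultiDRegField.lean`) and its
derived curves `Y_α` (`NoBVEstimatesMultiDDerivedCurves.lean`), the `Hᵐ` energy that is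
propagated uniformly in `δ` is the SYMMETRIZER-WEIGHTED one,
`E(t) = Σ_{|α| ≤ m} ⟪S(W(t)) Y_α(t), Y_α(t)⟫_{L²}`, `W = ρ_δ ⋆ U` [Majda1984, Ch. 2, (2.11)],
[TaylorPDEIII2011, Ch. 16, §1, (1.11) and §2]. This file builds the weight and differentiates
one summand:

* `IsSymmSmoothCoeff M L a b s` — the coefficient hypotheses of the whole energy method: tame
  coefficients (`IsTameCoeff`) which are moreover smooth with globally bounded derivatives of
  every order, and a smooth symmetrizer field `s` (bounded derivatives, `s(y)` and `s(y)aⱼ(y)`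
  symmetric, `s` uniformly coercive);
* `mulL2 m` — **multiplication by a bounded continuous operator field** as a bounded operator on
  `L²(ℝᵈ; ℝᵏ)` (`coeFn_mulL2`, `norm_mulL2_apply_le`, `inner_mulL2_eq_integral`, self-adjointness
  `inner_mulL2_comm`, coercivity `inner_mulL2_self_ge`, and the three-term bound
  `norm_mulL2_sub_sub_smul_le` used to differentiate in the field);
* `weightOp V = mulL2 (s ∘ (ρ_δ ⋆ V))`, `weightOpDeriv V = mulL2 (Ds(ρ_δ ⋆ V)[ρ_δ ⋆ F_δ(V)])` and
  `hasDerivAt_weightOp` — **along the flow the weight is differentiable in operator norm** with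
  the expected derivative (pointwise values of `ρ_δ ⋆ U(t)` are a bounded functional of `U(t)`,
  so the chain rule holds uniformly in `x`; second-order Taylor bound for `s`);
* `hasDerivAt_weightedTerm` — **the energy identity for one word**:
  `d/dt ⟪S Y_α, Y_α⟫ = ⟪S' Y_α, Y_α⟫ + 2 ⟪S F_δ^{(α)}(U), Y_α⟫` (`S` self-adjoint);
* `inner_weightOp_self_ge` / `inner_weightOp_self_le` — `c₀‖Y‖² ≤ ⟪S Y, Y⟫ ≤ K₀‖Y‖²`.

Everything is proved; no named fact and no `sorry` is introduced.

## References

* [Majda1984] A. Majda, *Compressible Fluid Flow and Systems of Conservation Laws in Several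
  Space Variables* (1984), Ch. 2, §2.1, (2.11)–(2.14).
* [TaylorPDEIII2011] M. E. Taylor, *Partial Differential Equations III*, 2nd ed. (2011), Ch. 16,
  §1 (1.11)–(1.13) and §2 (symmetrizable systems).
-/

noncomputable section

open MeasureTheory Set Function Filter Metric ContinuousLinearMap
open scoped ContDiff Topology ENNReal NNReal Convolution RealInnerProductSpace

namespace Literature.Barriers.AtomisticToContinuum

open Literature.Analysis.PDE Literature.Analysis.FunctionSpaces Literature.Analysis.ODE

variable {d k : ℕ}

/-- Shorthand: the state Hilbert space `W = ℝᵏ`. -/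
local notation "W" k => EuclideanSpace ℝ (Fin k)
/-- Shorthand: physical space `ℝᵈ`. -/
local notation "E" d => EuclideanSpace ℝ (Fin d)

/-! ### The coefficient hypotheses of the energy method -/

/-- **Smooth symmetrizable tame coefficients.** The recentred cut-off coefficients `aⱼ, b` of a
symmetrizable quasilinear system near a constant state together with the symmetrizer field `s`:
tame (`IsTameCoeff`), smooth with globally bounded derivatives of all orders (they are constant
outside a ball), `s(y)` and `s(y)aⱼ(y)` symmetric for the Euclidean inner product, and `s`
uniformly positive definite. [cite: Majda1984, Ch. 2 §2.1, (2.2)–(2.3)] -/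
structure IsSymmSmoothCoeff (M L : ℝ) (a : Fin d → (W k) → ((W k) →L[ℝ] (W k)))
    (b : (W k) → (W k)) (s : (W k) → ((W k) →L[ℝ] (W k))) : Prop
    extends IsTameCoeff M L a b where
  smooth_a : ∀ j, ContDiff ℝ ∞ (a j)
  smooth_b : ContDiff ℝ ∞ b
  smooth_s : ContDiff ℝ ∞ s
  bdd_a : ∀ j, ∀ i : ℕ, ∃ K : ℝ, ∀ y, ‖iteratedFDeriv ℝ i (a j) y‖ ≤ K
  bdd_b : ∀ i : ℕ, ∃ K : ℝ, ∀ y, ‖iteratedFDeriv ℝ i b y‖ ≤ K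
  bdd_s : ∀ i : ℕ, ∃ K : ℝ, ∀ y, ‖iteratedFDeriv ℝ i s y‖ ≤ K
  symm_s : ∀ y (u v : W k), ⟪s y u, v⟫ = ⟪u, s y v⟫
  symm_sa : ∀ j y (u v : W k), ⟪s y (a j y u), v⟫ = ⟪u, s y (a j y v)⟫
  coercive : ∃ c₀ : ℝ, 0 < c₀ ∧ ∀ y (v : W k), c₀ * ‖v‖ ^ 2 ≤ ⟪s y v, v⟫

namespace IsSymmSmoothCoeff

variable {M L : ℝ} {a : Fin d → (W k) → ((W k) →L[ℝ] (W k))} {b : (W k) → (W k)}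
  {s : (W k) → ((W k) →L[ℝ] (W k))}

/-- `‖s(y)‖ ≤ K₀`. [folklore] -/
theorem exists_norm_s_le (hS : IsSymmSmoothCoeff M L a b s) :
    ∃ K : ℝ, 0 ≤ K ∧ ∀ y, ‖s y‖ ≤ K := by
  obtain ⟨K, hK⟩ := hS.bdd_s 0
  refine ⟨max K 0, le_max_right _ _, fun y => ?_⟩
  have h := hK y
  rw [norm_iteratedFDeriv_zero] at h
  exact h.trans (le_max_left _ _)

/-- `‖Ds(y)‖ ≤ K₁`. [folklore] -/
theorem exists_norm_fderiv_s_le (hS : IsSymmSmoothCoeff M L a b s) :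
    ∃ K : ℝ, 0 ≤ K ∧ ∀ y, ‖fderiv ℝ s y‖ ≤ K := by
  obtain ⟨K, hK⟩ := hS.bdd_s 1
  refine ⟨max K 0, le_max_right _ _, fun y => ?_⟩
  have h := hK y
  rw [norm_iteratedFDeriv_one] at h
  exact h.trans (le_max_left _ _)

/-- `Ds` is `K₂`-Lipschitz (`‖D²s‖ ≤ K₂`). [folklore] -/
theorem exists_norm_fderiv_s_sub_le (hS : IsSymmSmoothCoeff M L a b s) :
    ∃ K : ℝ, 0 ≤ K ∧ ∀ y y', ‖fderiv ℝ s y - fderiv ℝ s y'‖ ≤ K * ‖y - y'‖ := by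
  obtain ⟨K, hK⟩ := hS.bdd_s 2
  have hK' : ∀ y, ‖iteratedFDeriv ℝ 2 s y‖ ≤ max K 0 := fun y => (hK y).trans (le_max_left _ _)
  have hs1 : ContDiff ℝ ∞ (fderiv ℝ s) := hS.smooth_s.fderiv_right (m := ∞) (by norm_cast)
  refine ⟨max K 0, le_max_right _ _, fun y y' => ?_⟩
  -- test against a vector `v`: `g(z) = Ds(z) v` has `‖Dg‖ ≤ K ‖v‖` (no third-order operator norms)
  refine opNorm_le_bound _ (by positivity) fun v => ?_
  set g : (W k) → ((W k) →L[ℝ] (W k)) := fun z => fderiv ℝ s z v with hg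
  have hgs : ContDiff ℝ ∞ g := hs1.clm_apply contDiff_const
  have hgd : Differentiable ℝ g := hgs.differentiable (by simp)
  have hgb : ∀ z, ‖fderiv ℝ g z‖ ≤ max K 0 * ‖v‖ := fun z => by
    rw [← norm_iteratedFDeriv_one]
    calc ‖iteratedFDeriv ℝ 1 g z‖ ≤ ‖v‖ * ‖iteratedFDeriv ℝ 1 (fderiv ℝ s) z‖ :=
          norm_iteratedFDeriv_clm_apply_const hs1.contDiffAt (by exact_mod_cast le_top)
      _ = ‖v‖ * ‖iteratedFDeriv ℝ 2 s z‖ := by rw [norm_iteratedFDeriv_fderiv]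
      _ ≤ ‖v‖ * max K 0 := mul_le_mul_of_nonneg_left (hK' z) (norm_nonneg _)
      _ = max K 0 * ‖v‖ := mul_comm _ _
  have hmv := (convex_univ).norm_image_sub_le_of_norm_fderiv_le (fun z _ => hgd z)
    (fun z _ => hgb z) (mem_univ y') (mem_univ y)
  calc ‖(fderiv ℝ s y - fderiv ℝ s y') v‖ = ‖g y - g y'‖ := by simp [hg]
    _ ≤ max K 0 * ‖v‖ * ‖y - y'‖ := hmv
    _ = max K 0 * ‖y - y'‖ * ‖v‖ := by ring

/-- **Second-order Taylor bound for the symmetrizer**: `‖s(p + q) - s(p) - Ds(p)q‖ ≤ K₂ ‖q‖²`.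
[folklore] -/
theorem exists_taylor_s (hS : IsSymmSmoothCoeff M L a b s) :
    ∃ K : ℝ, 0 ≤ K ∧ ∀ p q : W k, ‖s (p + q) - s p - fderiv ℝ s p q‖ ≤ K * ‖q‖ ^ 2 := by
  obtain ⟨K, hK0, hK⟩ := hS.exists_norm_fderiv_s_sub_le
  refine ⟨K, hK0, fun p q => ?_⟩
  have hd : Differentiable ℝ s := hS.smooth_s.differentiable (by simp)
  -- `g(y) = s(y) - Ds(p) y` has `‖Dg(y)‖ ≤ K ‖q‖` on the ball `B̄(p, ‖q‖)`
  set g : (W k) → ((W k) →L[ℝ] (W k)) := fun y => s y - (fderiv ℝ s p) y with hg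
  have hgd : ∀ y, HasFDerivAt g (fderiv ℝ s y - fderiv ℝ s p) y := fun y =>
    (hd y).hasFDerivAt.sub (fderiv ℝ s p).hasFDerivAt
  have hbound : ∀ y ∈ closedBall p ‖q‖, ‖fderiv ℝ g y‖ ≤ K * ‖q‖ := fun y hy => by
    rw [(hgd y).fderiv]
    refine (hK y p).trans (mul_le_mul_of_nonneg_left ?_ hK0)
    rwa [mem_closedBall, dist_eq_norm] at hy
  have hmv := (convex_closedBall p ‖q‖).norm_image_sub_le_of_norm_fderiv_le
    (fun y _ => (hgd y).differentiableAt) hbound (mem_closedBall_self (norm_nonneg q))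
    (show p + q ∈ closedBall p ‖q‖ by simp [mem_closedBall, dist_eq_norm])
  have heq : g (p + q) - g p = s (p + q) - s p - fderiv ℝ s p q := by
    simp only [hg, map_add]
    abel
  rw [heq, add_sub_cancel_left] at hmv
  calc ‖s (p + q) - s p - fderiv ℝ s p q‖ ≤ K * ‖q‖ * ‖q‖ := hmv
    _ = K * ‖q‖ ^ 2 := by ring

/-- The coercivity constant. [folklore] -/
theorem exists_coercive (hS : IsSymmSmoothCoeff M L a b s) :
    ∃ c₀ : ℝ, 0 < c₀ ∧ ∀ y (v : W k), c₀ * ‖v‖ ^ 2 ≤ ⟪s y v, v⟫ := hS.coercive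

end IsSymmSmoothCoeff

/-! ### Multiplication operators on `L²(ℝᵈ; ℝᵏ)` -/

section MulL2

variable {m : (E d) → ((W k) →L[ℝ] (W k))}

/-- A bounded continuous operator field applied to an `L²` element is in `L²`. [folklore] -/
theorem memLp_clm_apply_Lp (hm : Continuous m) {A : ℝ} (hA : ∀ x, ‖m x‖ ≤ A)
    (U : Lp (W k) 2 (volume : Measure (E d))) :
    MemLp (fun x => m x (U x)) 2 (volume : Measure (E d)) :=
  (Lp.memLp U).of_le_mul (aestronglyMeasurable_clm_apply hm (Lp.memLp U).aestronglyMeasurable)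
    (Eventually.of_forall fun x =>
      ((m x).le_opNorm _).trans (mul_le_mul_of_nonneg_right (hA x) (norm_nonneg _)))

/-- **Multiplication by a bounded continuous operator field** `m : ℝᵈ → (ℝᵏ →L ℝᵏ)` as a bounded
operator on `L²(ℝᵈ; ℝᵏ)`. [cite: Majda1984, Ch. 2 §2.1, (2.11)] -/
def mulL2 (m : (E d) → ((W k) →L[ℝ] (W k))) (hm : Continuous m) (hb : ∃ A : ℝ, ∀ x, ‖m x‖ ≤ A) :
    Lp (W k) 2 (volume : Measure (E d)) →L[ℝ] Lp (W k) 2 (volume : Measure (E d)) :=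
  LinearMap.mkContinuous
    { toFun := fun U => (memLp_clm_apply_Lp hm (Classical.choose_spec hb) U).toLp _
      map_add' := fun U V => by
        rw [← MemLp.toLp_add]
        refine MemLp.toLp_congr _ _ ?_
        filter_upwards [Lp.coeFn_add U V] with x hx
        change m x ((U + V : Lp (W k) 2 (volume : Measure (E d))) x) = m x (U x) + m x (V x)
        rw [hx, Pi.add_apply, map_add]
      map_smul' := fun c U => by
        rw [RingHom.id_apply, ← MemLp.toLp_const_smul]
        refine MemLp.toLp_congr _ _ ?_
        filter_upwards [Lp.coeFn_smul c U] with x hx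
        change m x ((c • U : Lp (W k) 2 (volume : Measure (E d))) x) = c • m x (U x)
        rw [hx, Pi.smul_apply, ContinuousLinearMap.map_smul] }
    (max (Classical.choose hb) 0) fun U => by
      simp only [LinearMap.coe_mk, AddHom.coe_mk]
      refine Lp.norm_le_mul_norm_of_ae_le_mul ?_
      filter_upwards [MemLp.coeFn_toLp (memLp_clm_apply_Lp hm (Classical.choose_spec hb) U)]
        with x hx
      rw [hx]
      exact ((m x).le_opNorm _).trans (mul_le_mul_of_nonneg_right
        ((Classical.choose_spec hb x).trans (le_max_left _ _)) (norm_nonneg _))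

/-- The values of `mulL2 m` are represented by `x ↦ m(x) U(x)` almost everywhere. [folklore] -/
theorem coeFn_mulL2 (hm : Continuous m) (hb : ∃ A : ℝ, ∀ x, ‖m x‖ ≤ A)
    (U : Lp (W k) 2 (volume : Measure (E d))) :
    (mulL2 m hm hb U : (E d) → (W k)) =ᵐ[(volume : Measure (E d))] fun x => m x (U x) :=
  MemLp.coeFn_toLp (memLp_clm_apply_Lp hm (Classical.choose_spec hb) U)

/-- **Operator bound**: `‖m U‖₂ ≤ A ‖U‖₂` for any bound `A ≥ 0` of `‖m‖`. [folklore] -/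
theorem norm_mulL2_apply_le (hm : Continuous m) (hb : ∃ A : ℝ, ∀ x, ‖m x‖ ≤ A) {A : ℝ}
    (hA : ∀ x, ‖m x‖ ≤ A) (U : Lp (W k) 2 (volume : Measure (E d))) :
    ‖mulL2 m hm hb U‖ ≤ A * ‖U‖ := by
  refine Lp.norm_le_mul_norm_of_ae_le_mul ?_
  filter_upwards [coeFn_mulL2 hm hb U] with x hx
  rw [hx]
  exact ((m x).le_opNorm _).trans (mul_le_mul_of_nonneg_right (hA x) (norm_nonneg _))

/-- **The inner product against a multiplication operator is an integral**:
`⟪m U, V⟫ = ∫ ⟪m(x) U(x), V(x)⟫ dx`. [folklore] -/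
theorem inner_mulL2_eq_integral (hm : Continuous m) (hb : ∃ A : ℝ, ∀ x, ‖m x‖ ≤ A)
    (U V : Lp (W k) 2 (volume : Measure (E d))) :
    ⟪mulL2 m hm hb U, V⟫ = ∫ x, ⟪m x (U x), V x⟫ := by
  rw [L2.inner_def]
  refine integral_congr_ae ?_
  filter_upwards [coeFn_mulL2 hm hb U] with x hx
  rw [hx]

/-- **Self-adjointness**: if every `m(x)` is symmetric then `⟪m U, V⟫ = ⟪U, m V⟫`. [folklore] -/
theorem inner_mulL2_comm (hm : Continuous m) (hb : ∃ A : ℝ, ∀ x, ‖m x‖ ≤ A)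
    (hsym : ∀ x (u v : W k), ⟪m x u, v⟫ = ⟪u, m x v⟫)
    (U V : Lp (W k) 2 (volume : Measure (E d))) :
    ⟪mulL2 m hm hb U, V⟫ = ⟪U, mulL2 m hm hb V⟫ := by
  rw [inner_mulL2_eq_integral, real_inner_comm (mulL2 m hm hb V) U, inner_mulL2_eq_integral]
  refine integral_congr_ae (Eventually.of_forall fun x => ?_)
  change ⟪m x (U x), V x⟫ = ⟪m x (V x), U x⟫
  rw [hsym, real_inner_comm]

/-- **Coercivity passes to `L²`**: if `c₀‖v‖² ≤ ⟪m(x)v, v⟫` for all `x, v` then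
`c₀‖U‖² ≤ ⟪m U, U⟫`. [folklore] -/
theorem inner_mulL2_self_ge (hm : Continuous m) (hb : ∃ A : ℝ, ∀ x, ‖m x‖ ≤ A) {c₀ : ℝ}
    (hc : ∀ x (v : W k), c₀ * ‖v‖ ^ 2 ≤ ⟪m x v, v⟫) (U : Lp (W k) 2 (volume : Measure (E d))) :
    c₀ * ‖U‖ ^ 2 ≤ ⟪mulL2 m hm hb U, U⟫ := by
  rw [inner_mulL2_eq_integral]
  have hUU : Integrable (fun x => ⟪(U : (E d) → (W k)) x, (U : (E d) → (W k)) x⟫)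
      (volume : Measure (E d)) := L2.integrable_inner U U
  have hmU : Integrable (fun x => ⟪m x (U x), (U : (E d) → (W k)) x⟫) (volume : Measure (E d)) := by
    have h := L2.integrable_inner (𝕜 := ℝ) (mulL2 m hm hb U) U
    refine h.congr ?_
    filter_upwards [coeFn_mulL2 hm hb U] with x hx
    rw [hx]
  have hsq : ‖U‖ ^ 2 = ∫ x, ⟪(U : (E d) → (W k)) x, (U : (E d) → (W k)) x⟫ := by
    rw [← L2.inner_def, real_inner_self_eq_norm_sq]
  rw [hsq, ← integral_const_mul]
  refine integral_mono (hUU.const_mul c₀) hmU fun x => ?_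
  change c₀ * ⟪(U : (E d) → (W k)) x, (U : (E d) → (W k)) x⟫ ≤ ⟪m x (U x), (U : (E d) → (W k)) x⟫
  rw [real_inner_self_eq_norm_sq]
  exact hc x _

/-- **Upper bound**: `⟪m U, U⟫ ≤ A ‖U‖²`. [folklore] -/
theorem inner_mulL2_self_le (hm : Continuous m) (hb : ∃ A : ℝ, ∀ x, ‖m x‖ ≤ A) {A : ℝ}
    (hA : ∀ x, ‖m x‖ ≤ A) (U : Lp (W k) 2 (volume : Measure (E d))) :
    ⟪mulL2 m hm hb U, U⟫ ≤ A * ‖U‖ ^ 2 := by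
  calc ⟪mulL2 m hm hb U, U⟫ ≤ ‖mulL2 m hm hb U‖ * ‖U‖ := real_inner_le_norm _ _
    _ ≤ A * ‖U‖ * ‖U‖ := mul_le_mul_of_nonneg_right (norm_mulL2_apply_le hm hb hA U) (norm_nonneg _)
    _ = A * ‖U‖ ^ 2 := by ring

/-- **Three-term bound** (used to differentiate `mulL2` in the field): if
`‖m₁(x) - m₂(x) - h m₃(x)‖ ≤ η` for all `x` then `‖m₁U - m₂U - h m₃U‖ ≤ η ‖U‖`. [folklore] -/
theorem norm_mulL2_sub_sub_smul_le {m₁ m₂ m₃ : (E d) → ((W k) →L[ℝ] (W k))}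
    (hm₁ : Continuous m₁) (hb₁ : ∃ A : ℝ, ∀ x, ‖m₁ x‖ ≤ A)
    (hm₂ : Continuous m₂) (hb₂ : ∃ A : ℝ, ∀ x, ‖m₂ x‖ ≤ A)
    (hm₃ : Continuous m₃) (hb₃ : ∃ A : ℝ, ∀ x, ‖m₃ x‖ ≤ A) {h η : ℝ}
    (hη : ∀ x, ‖m₁ x - m₂ x - h • m₃ x‖ ≤ η) (U : Lp (W k) 2 (volume : Measure (E d))) :
    ‖mulL2 m₁ hm₁ hb₁ U - mulL2 m₂ hm₂ hb₂ U - h • mulL2 m₃ hm₃ hb₃ U‖ ≤ η * ‖U‖ := by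
  refine Lp.norm_le_mul_norm_of_ae_le_mul ?_
  filter_upwards [coeFn_mulL2 hm₁ hb₁ U, coeFn_mulL2 hm₂ hb₂ U, coeFn_mulL2 hm₃ hb₃ U,
    Lp.coeFn_sub (mulL2 m₁ hm₁ hb₁ U - mulL2 m₂ hm₂ hb₂ U) (h • mulL2 m₃ hm₃ hb₃ U),
    Lp.coeFn_sub (mulL2 m₁ hm₁ hb₁ U) (mulL2 m₂ hm₂ hb₂ U), Lp.coeFn_smul h (mulL2 m₃ hm₃ hb₃ U)]
    with x h1 h2 h3 h4 h5 h6
  rw [h4, Pi.sub_apply, h5, Pi.sub_apply, h6, Pi.smul_apply, h1, h2, h3]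
  have heq : m₁ x (U x) - m₂ x (U x) - h • m₃ x (U x) = (m₁ x - m₂ x - h • m₃ x) (U x) := by
    simp
  rw [heq]
  exact (le_opNorm _ _).trans (mul_le_mul_of_nonneg_right (hη x) (norm_nonneg _))

end MulL2

/-! ### The weight `S(ρ_δ ⋆ V)` and its derivative along the flow -/

section Weight

variable {M L : ℝ} {a : Fin d → (W k) → ((W k) →L[ℝ] (W k))} {b : (W k) → (W k)}
  {s : (W k) → ((W k) →L[ℝ] (W k))}

/-- The weight field `x ↦ s((ρ_δ ⋆ V)(x))` is continuous. [folklore] -/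
theorem continuous_s_smoothRep (hS : IsSymmSmoothCoeff M L a b s) {δ : ℝ} (hδ : 0 < δ)
    (V : Lp (W k) 2 (volume : Measure (E d))) :
    Continuous fun x => s (smoothRep (moll (Fin d) hδ) V x) :=
  hS.smooth_s.continuous.comp
    (contDiff_smoothRep (contDiff_moll hδ) (hasCompactSupport_moll hδ) V).continuous

/-- The weight field is bounded. [folklore] -/
theorem bdd_s_smoothRep (hS : IsSymmSmoothCoeff M L a b s) {δ : ℝ} (hδ : 0 < δ)
    (V : Lp (W k) 2 (volume : Measure (E d))) :
    ∃ A : ℝ, ∀ x, ‖s (smoothRep (moll (Fin d) hδ) V x)‖ ≤ A := by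
  obtain ⟨K, -, hK⟩ := hS.exists_norm_s_le
  exact ⟨K, fun _ => hK _⟩

/-- **The weight** `S(ρ_δ ⋆ V)`: multiplication by `x ↦ s((ρ_δ ⋆ V)(x))` on `L²`.
[cite: Majda1984, Ch. 2 §2.1, (2.11)] -/
def weightOp (hS : IsSymmSmoothCoeff M L a b s) {δ : ℝ} (hδ : 0 < δ)
    (V : Lp (W k) 2 (volume : Measure (E d))) :
    Lp (W k) 2 (volume : Measure (E d)) →L[ℝ] Lp (W k) 2 (volume : Measure (E d)) :=
  mulL2 (fun x => s (smoothRep (moll (Fin d) hδ) V x)) (continuous_s_smoothRep hS hδ V)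
    (bdd_s_smoothRep hS hδ V)

/-- The derivative field `x ↦ Ds((ρ_δ ⋆ V)(x))[(ρ_δ ⋆ F_δ(V))(x)]` is continuous. [folklore] -/
theorem continuous_ds_smoothRep (hS : IsSymmSmoothCoeff M L a b s) {δ : ℝ} (hδ : 0 < δ)
    (V : Lp (W k) 2 (volume : Measure (E d))) :
    Continuous fun x => fderiv ℝ s (smoothRep (moll (Fin d) hδ) V x)
      (smoothRep (moll (Fin d) hδ) (regField hS.toIsTameCoeff hδ V) x) := by
  have h1 : Continuous fun x => fderiv ℝ s (smoothRep (moll (Fin d) hδ) V x) :=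
    (hS.smooth_s.continuous_fderiv (by simp)).comp
      (contDiff_smoothRep (contDiff_moll hδ) (hasCompactSupport_moll hδ) V).continuous
  exact h1.clm_apply
    (contDiff_smoothRep (contDiff_moll hδ) (hasCompactSupport_moll hδ) _).continuous

/-- The derivative field is bounded. [folklore] -/
theorem bdd_ds_smoothRep (hS : IsSymmSmoothCoeff M L a b s) {δ : ℝ} (hδ : 0 < δ)
    (V : Lp (W k) 2 (volume : Measure (E d))) :
    ∃ A : ℝ, ∀ x, ‖fderiv ℝ s (smoothRep (moll (Fin d) hδ) V x)
      (smoothRep (moll (Fin d) hδ) (regField hS.toIsTameCoeff hδ V) x)‖ ≤ A := by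
  obtain ⟨K₁, hK₁0, hK₁⟩ := hS.exists_norm_fderiv_s_le
  refine ⟨K₁ * (l2norm (moll (Fin d) hδ) * ‖regField hS.toIsTameCoeff hδ V‖), fun x => ?_⟩
  refine (le_opNorm _ _).trans (mul_le_mul (hK₁ _) ?_ (norm_nonneg _) hK₁0)
  exact norm_smoothRep_moll_le hδ _ x

/-- **The derivative of the weight along the flow**: multiplication by
`x ↦ Ds((ρ_δ ⋆ V)(x))[(ρ_δ ⋆ F_δ(V))(x)]`. [cite: Majda1984, Ch. 2 §2.1, (2.13)] -/
def weightOpDeriv (hS : IsSymmSmoothCoeff M L a b s) {δ : ℝ} (hδ : 0 < δ)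
    (V : Lp (W k) 2 (volume : Measure (E d))) :
    Lp (W k) 2 (volume : Measure (E d)) →L[ℝ] Lp (W k) 2 (volume : Measure (E d)) :=
  mulL2 (fun x => fderiv ℝ s (smoothRep (moll (Fin d) hδ) V x)
      (smoothRep (moll (Fin d) hδ) (regField hS.toIsTameCoeff hδ V) x))
    (continuous_ds_smoothRep hS hδ V) (bdd_ds_smoothRep hS hδ V)

/-- The weight is self-adjoint. [folklore] -/
theorem inner_weightOp_comm (hS : IsSymmSmoothCoeff M L a b s) {δ : ℝ} (hδ : 0 < δ)
    (V U U' : Lp (W k) 2 (volume : Measure (E d))) :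
    ⟪weightOp hS hδ V U, U'⟫ = ⟪U, weightOp hS hδ V U'⟫ :=
  inner_mulL2_comm _ _ (fun _ u v => hS.symm_s _ u v) U U'

/-- **Coercivity of the weight**: `c₀‖U‖² ≤ ⟪S(ρ_δ ⋆ V) U, U⟫` with the coercivity constant of
`s`. [cite: Majda1984, Ch. 2 §2.1, (2.12)] -/
theorem inner_weightOp_self_ge (hS : IsSymmSmoothCoeff M L a b s) {δ : ℝ} (hδ : 0 < δ) {c₀ : ℝ}
    (hc : ∀ y (v : W k), c₀ * ‖v‖ ^ 2 ≤ ⟪s y v, v⟫)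
    (V U : Lp (W k) 2 (volume : Measure (E d))) :
    c₀ * ‖U‖ ^ 2 ≤ ⟪weightOp hS hδ V U, U⟫ :=
  inner_mulL2_self_ge _ _ (fun _ v => hc _ v) U

/-- **Upper bound for the weight**: `⟪S(ρ_δ ⋆ V) U, U⟫ ≤ K₀‖U‖²` for any bound `K₀ ≥ 0` of `‖s‖`.
[cite: Majda1984, Ch. 2 §2.1, (2.12)] -/
theorem inner_weightOp_self_le (hS : IsSymmSmoothCoeff M L a b s) {δ : ℝ} (hδ : 0 < δ) {K₀ : ℝ}
    (hK₀ : ∀ y, ‖s y‖ ≤ K₀) (V U : Lp (W k) 2 (volume : Measure (E d))) :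
    ⟪weightOp hS hδ V U, U⟫ ≤ K₀ * ‖U‖ ^ 2 :=
  inner_mulL2_self_le _ _ (fun _ => hK₀ _) U

/-- `‖S(ρ_δ ⋆ V) U‖ ≤ K₀ ‖U‖`. [folklore] -/
theorem norm_weightOp_apply_le (hS : IsSymmSmoothCoeff M L a b s) {δ : ℝ} (hδ : 0 < δ) {K₀ : ℝ}
    (hK₀ : ∀ y, ‖s y‖ ≤ K₀) (V U : Lp (W k) 2 (volume : Measure (E d))) :
    ‖weightOp hS hδ V U‖ ≤ K₀ * ‖U‖ :=
  norm_mulL2_apply_le _ _ (fun _ => hK₀ _) U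

/-- `‖S'(V) U‖ ≤ K₁ ‖ρ_δ‖₂ ‖F_δ(V)‖ ‖U‖` for any bound `K₁ ≥ 0` of `‖Ds‖`. [folklore] -/
theorem norm_weightOpDeriv_apply_le (hS : IsSymmSmoothCoeff M L a b s) {δ : ℝ} (hδ : 0 < δ)
    {K₁ : ℝ} (hK₁0 : 0 ≤ K₁) (hK₁ : ∀ y, ‖fderiv ℝ s y‖ ≤ K₁)
    (V U : Lp (W k) 2 (volume : Measure (E d))) :
    ‖weightOpDeriv hS hδ V U‖ ≤
      K₁ * (l2norm (moll (Fin d) hδ) * ‖regField hS.toIsTameCoeff hδ V‖) * ‖U‖ := by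
  refine norm_mulL2_apply_le _ _ (fun x => ?_) U
  refine (le_opNorm _ _).trans (mul_le_mul (hK₁ _) ?_ (norm_nonneg _) hK₁0)
  exact norm_smoothRep_moll_le hδ _ x

/-- A sharper pointwise bound: `‖S'(V)‖ ≤ K₁ sup‖ρ_δ ⋆ F_δ(V)‖`. [folklore] -/
theorem norm_weightOpDeriv_apply_le_of_sup (hS : IsSymmSmoothCoeff M L a b s) {δ : ℝ} (hδ : 0 < δ)
    {K₁ : ℝ} (hK₁0 : 0 ≤ K₁) (hK₁ : ∀ y, ‖fderiv ℝ s y‖ ≤ K₁)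
    (V : Lp (W k) 2 (volume : Measure (E d))) {R : ℝ}
    (hR : ∀ x, ‖smoothRep (moll (Fin d) hδ) (regField hS.toIsTameCoeff hδ V) x‖ ≤ R)
    (U : Lp (W k) 2 (volume : Measure (E d))) :
    ‖weightOpDeriv hS hδ V U‖ ≤ K₁ * R * ‖U‖ := by
  refine norm_mulL2_apply_le _ _ (fun x => ?_) U
  exact (le_opNorm _ _).trans (mul_le_mul (hK₁ _) (hR x) (norm_nonneg _) hK₁0)

set_option maxHeartbeats 400000 in
/-- **Along the flow the weight is differentiable in operator norm**, with derivative
`weightOpDeriv`: pointwise values of `ρ_δ ⋆ U(t)` are a bounded linear functional (norm `≤ ‖ρ_δ‖₂`)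
of `U(t)`, so `t ↦ (ρ_δ ⋆ U(t))(x)` is differentiable uniformly in `x`, and `s` has a uniform
second-order Taylor bound. [cite: Majda1984, Ch. 2 §2.1, (2.13)] -/
theorem hasDerivAt_weightOp (hS : IsSymmSmoothCoeff M L a b s) {δ : ℝ} (hδ : 0 < δ)
    {U : ℝ → Lp (W k) 2 (volume : Measure (E d))}
    (hU : ∀ t, HasDerivAt U (regField hS.toIsTameCoeff hδ (U t)) t) (t : ℝ) :
    HasDerivAt (fun τ => weightOp hS hδ (U τ)) (weightOpDeriv hS hδ (U t)) t := by
  set ρ := moll (Fin d) hδ with hρ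
  set F := regField hS.toIsTameCoeff hδ with hF
  obtain ⟨K₁, hK₁0, hK₁⟩ := hS.exists_norm_fderiv_s_le
  obtain ⟨K₂, hK₂0, hK₂⟩ := hS.exists_taylor_s
  set Λ : ℝ := l2norm ρ with hΛ
  have hΛ0 : 0 ≤ Λ := l2norm_nonneg _
  -- the evaluation functionals `ℓ_x(V) = (ρ ⋆ V)(x)`, of norm `≤ Λ`
  have hev : ∀ (x : E d) (V : Lp (W k) 2 (volume : Measure (E d))),
      evalL2 ρ (continuous_moll hδ) (hasCompactSupport_moll hδ) x V = smoothRep ρ V x :=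
    fun x V => by rw [evalL2_apply, smoothRep_def]
  have hevn : ∀ (x : E d) (V : Lp (W k) 2 (volume : Measure (E d))),
      ‖smoothRep ρ V x‖ ≤ Λ * ‖V‖ := fun x V => norm_smoothRep_moll_le hδ V x
  rw [hasDerivAt_iff_isLittleO_nhds_zero, Asymptotics.isLittleO_iff]
  intro ε hε
  -- differentiability of `U` at `t`, quantitatively
  have hUd := hU t
  rw [hasDerivAt_iff_isLittleO_nhds_zero, Asymptotics.isLittleO_iff] at hUd
  set ε₁ : ℝ := ε / (2 * (K₁ * Λ + 1)) with hε₁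
  have hden : 0 < K₁ * Λ + 1 := by positivity
  have hε₁0 : 0 < ε₁ := by positivity
  have h1 : ∀ᶠ h : ℝ in 𝓝 0, ‖U (t + h) - U t - h • F (U t)‖ ≤ ε₁ * ‖h‖ := hUd hε₁0
  -- smallness of `h`
  set Q : ℝ := K₂ * (Λ * (‖F (U t)‖ + ε₁)) ^ 2 with hQ
  have hQ0 : 0 ≤ Q := by positivity
  have h2 : ∀ᶠ h : ℝ in 𝓝 0, Q * ‖h‖ ≤ ε / 2 := by
    have hc : Continuous fun h : ℝ => Q * ‖h‖ := continuous_const.mul continuous_norm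
    have h0 : Q * ‖(0 : ℝ)‖ < ε / 2 := by simp; positivity
    exact (hc.tendsto 0).eventually (Iio_mem_nhds h0) |>.mono fun h hh => le_of_lt hh
  filter_upwards [h1, h2] with h hh1 hh2
  -- the pointwise three-term bound
  have hpt : ∀ x : E d,
      ‖s (smoothRep ρ (U (t + h)) x) - s (smoothRep ρ (U t) x) -
        h • fderiv ℝ s (smoothRep ρ (U t) x) (smoothRep ρ (F (U t)) x)‖ ≤ ε * ‖h‖ := by
    intro x
    set p : W k := smoothRep ρ (U t) x with hp
    set q : W k := smoothRep ρ (U (t + h) - U t) x with hq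
    set r : W k := smoothRep ρ (U (t + h) - U t - h • F (U t)) x with hr
    have hpq : smoothRep ρ (U (t + h)) x = p + q := by
      rw [hp, hq, ← hev, ← hev, ← hev, ← ContinuousLinearMap.map_add]
      congr 1
      abel
    have hr' : r = q - h • smoothRep ρ (F (U t)) x := by
      rw [hr, hq, ← hev, ← hev, ← hev, ContinuousLinearMap.map_sub, ContinuousLinearMap.map_smul]
    have hqn : ‖q‖ ≤ Λ * ((‖F (U t)‖ + ε₁) * ‖h‖) := by
      refine (hevn x _).trans (mul_le_mul_of_nonneg_left ?_ hΛ0)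
      calc ‖U (t + h) - U t‖ = ‖(U (t + h) - U t - h • F (U t)) + h • F (U t)‖ := by
            rw [sub_add_cancel]
        _ ≤ ‖U (t + h) - U t - h • F (U t)‖ + ‖h • F (U t)‖ := norm_add_le _ _
        _ ≤ ε₁ * ‖h‖ + ‖h‖ * ‖F (U t)‖ := by rw [norm_smul]; exact add_le_add hh1 le_rfl
        _ = (‖F (U t)‖ + ε₁) * ‖h‖ := by ring
    have hrn : ‖r‖ ≤ Λ * (ε₁ * ‖h‖) := (hevn x _).trans (mul_le_mul_of_nonneg_left hh1 hΛ0)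
    have hsplit : s (smoothRep ρ (U (t + h)) x) - s p - h • fderiv ℝ s p (smoothRep ρ (F (U t)) x)
        = (s (p + q) - s p - fderiv ℝ s p q) + fderiv ℝ s p r := by
      rw [hpq, hr', ContinuousLinearMap.map_sub, ContinuousLinearMap.map_smul]
      abel
    rw [hsplit]
    calc ‖(s (p + q) - s p - fderiv ℝ s p q) + fderiv ℝ s p r‖
        ≤ ‖s (p + q) - s p - fderiv ℝ s p q‖ + ‖fderiv ℝ s p r‖ := norm_add_le _ _
      _ ≤ K₂ * ‖q‖ ^ 2 + K₁ * ‖r‖ :=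
          add_le_add (hK₂ p q) ((le_opNorm _ _).trans (mul_le_mul_of_nonneg_right (hK₁ p)
            (norm_nonneg _)))
      _ ≤ K₂ * (Λ * ((‖F (U t)‖ + ε₁) * ‖h‖)) ^ 2 + K₁ * (Λ * (ε₁ * ‖h‖)) := by
          gcongr
      _ = (Q * ‖h‖) * ‖h‖ + (K₁ * Λ) * ε₁ * ‖h‖ := by rw [hQ]; ring
      _ ≤ (ε / 2) * ‖h‖ + (ε / 2) * ‖h‖ := by
          refine add_le_add (mul_le_mul_of_nonneg_right hh2 (norm_nonneg _))
            (mul_le_mul_of_nonneg_right ?_ (norm_nonneg _))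
          rw [hε₁]
          rw [show K₁ * Λ * (ε / (2 * (K₁ * Λ + 1))) = (ε / 2) * (K₁ * Λ / (K₁ * Λ + 1)) by
            field_simp]
          refine mul_le_of_le_one_right (by positivity) ?_
          rw [div_le_one hden]
          linarith
      _ = ε * ‖h‖ := by ring
  -- the operator-norm bound
  refine opNorm_le_bound _ (by positivity) fun V => ?_
  have happ : (weightOp hS hδ (U (t + h)) - weightOp hS hδ (U t) - h • weightOpDeriv hS hδ (U t)) V =
      weightOp hS hδ (U (t + h)) V - weightOp hS hδ (U t) V - h • weightOpDeriv hS hδ (U t) V := by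
    simp
  rw [happ]
  exact norm_mulL2_sub_sub_smul_le _ _ _ _ _ _ hpt V

end Weight

/-! ### The energy identity for one word -/

section Energy

variable {M L : ℝ} {a : Fin d → (W k) → ((W k) →L[ℝ] (W k))} {b : (W k) → (W k)}
  {s : (W k) → ((W k) →L[ℝ] (W k))} {u₀ : (E d) → (W k)}

/-- **The time derivative of one weighted energy summand**:
`d/dt ⟪S(W) Y_α, Y_α⟫ = ⟪S'(W) Y_α, Y_α⟫ + 2 ⟪S(W) F_δ^{(α)}(U), Y_α⟫` along a solution of the
regularised equation (`S` self-adjoint). [cite: Majda1984, Ch. 2 §2.1, (2.13)];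
[cite: TaylorPDEIII2011, Ch. 16 §1, (1.11)] -/
theorem hasDerivAt_weightedTerm (hS : IsSymmSmoothCoeff M L a b s) {δ : ℝ} (hδ : 0 < δ)
    (hu₀ : ContDiff ℝ ∞ u₀) (hu₀c : HasCompactSupport u₀)
    {U : ℝ → Lp (W k) 2 (volume : Measure (E d))}
    (hU : ∀ t, HasDerivAt U (regField hS.toIsTameCoeff hδ (U t)) t) (α : List (Fin d)) (t : ℝ) :
    HasDerivAt (fun τ => ⟪weightOp hS hδ (U τ) (dcurve hS.toIsTameCoeff hδ hu₀ hu₀c U α τ),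
        dcurve hS.toIsTameCoeff hδ hu₀ hu₀c U α τ⟫)
      (⟪weightOpDeriv hS hδ (U t) (dcurve hS.toIsTameCoeff hδ hu₀ hu₀c U α t),
          dcurve hS.toIsTameCoeff hδ hu₀ hu₀c U α t⟫ +
        2 * ⟪weightOp hS hδ (U t) (derivedField hS.toIsTameCoeff hδ α (U t)),
          dcurve hS.toIsTameCoeff hδ hu₀ hu₀c U α t⟫) t := by
  have hUc : Continuous U := continuous_iff_continuousAt.2 fun τ => (hU τ).continuousAt
  have hY := hasDerivAt_dcurve hS.toIsTameCoeff hδ hu₀ hu₀c hUc α t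
  have hSW := hasDerivAt_weightOp hS hδ hU t
  have h1 := hSW.clm_apply hY
  have h2 := h1.inner ℝ hY
  refine h2.congr_deriv ?_
  set Y := dcurve hS.toIsTameCoeff hδ hu₀ hu₀c U α t
  set Y' := derivedField hS.toIsTameCoeff hδ α (U t)
  rw [inner_add_left, inner_weightOp_comm hS hδ (U t) Y Y',
    real_inner_comm (weightOp hS hδ (U t) Y') Y]
  ring

end Energy

end Literature.Barriers.AtomisticToContinuum

end
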